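import Literature.NumberTheory.EllipticCurves.SupersingularDensitySerreMonomialProofs
import Literature.NumberTheory.LFunctions.ChebotarevNaturalUpperBoundProofs
import HarnessLib

/-!
# Density `0` of the supersingular primes (Serre) — proofs, part 6: Serre's theorem from the
# open image theorem alone (unconditional natural-density input)

Sixth `…Proofs` file (theorems only, nothing is defined) of the series on the named fact
`WeierstrassCurve.serre_supersingular_density_zero` (`SupersingularDensity`; Serre 1981, §8,
Thm. 20 / Cor. 2: *for `E/ℚ` without complex multiplication the supersingular primes have natural
density `0`*).

## Main result

`WeierstrassCurve.serre_supersingular_density_zero_of_openImage`: **Serre's density-zero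
theorem follows from Serre's open image theorem** (the tree's named fact
`Literature.NumberTheory.EllipticCurves.serre_open_image`, Serre 1972, §4.2 Thm. 2, mod-`ℓ`
surjectivity for all large `ℓ`) **alone** — the natural-density Chebotarev hypothesis of part 4
(`serre_supersingular_density_zero_of_chebotarev_of_openImage`) is discharged unconditionally.

The argument is Serre's (1981, pp. 123–124 (a), with Remarque 1, p. 190: use `φ_ℓ`, `ℓ` variable,
in `GL₂(𝔽_ℓ)`; "`C_ℓ` est de mesure nulle dans `G_ℓ`, ce qui entraîne (a) grâce au théorème de
Chebotarev"), with Chebotarev's theorem replaced by the following unconditional upper bound.  For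
a prime `ℓ ≥ ℓ₀(E)`, `ℓ ≥ 5`, the representation `ρ̄_{E,ℓ} : Γ_ℚ → Aut(E[ℓ]) ≅ GL₂(𝔽_ℓ)` is onto
(open image); let `N ≤ GL₂(𝔽_ℓ)` be the monomial subgroup and `M = ℚ(E[ℓ])^N` its fixed field.
Every trace-zero `g ∈ GL₂(𝔽_ℓ)` has at least `k = (ℓ − 3)/2` fixed points on `GL₂(𝔽_ℓ)/N` (part 5,
`exists_subgroup_GL2_fixedPoints`), so every prime `p` unramified in `ℚ(E[ℓ])` with trace-zero
Frobenius has at least `k` degree-one primes of `M` above it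
(`GaloisRepresentations/FrobeniusFixedFieldPrimesProofs`, Marcus Ch. 4 Thm. 33); by Landau's
prime ideal theorem for `M` (`π_M(x) ∼ π(x)`, the tree's theorem `primeIdealTheorem_holds`) the set
of such `p` has upper natural density `≤ 1/k ≤ 2/(ℓ − 3)`
(`LFunctions/ChebotarevNaturalUpperBoundProofs`, `Chebotarev.eventually_card_primesLE_filter_frobPrimes_le`).
The good supersingular primes `p ≥ 5`, `p ≠ ℓ`, are among them (parts 2–3: `a_p = 0`, unramified,
`tr ρ̄_ℓ(Frob_p) = a_p mod ℓ = 0`), for every such `ℓ`; hence they have density `0` (part 1,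
squeeze).

The discharge `serre_supersingular_density_zero_holds` is this theorem applied to
`serre_open_image`, once that named fact (Serre 1972) is a theorem of the tree.

## References

* [Serre1981] J.-P. Serre, *Quelques applications du théorème de densité de Chebotarev*, Publ.
  Math. IHÉS 54 (1981): pp. 123–124 (a); §2.1; §8 Thm. 20, Cor. 2, Remarque 1 (pp. 189–190).
* [Serre1972] J.-P. Serre, *Propriétés galoisiennes des points d'ordre fini des courbes
  elliptiques*, Invent. Math. 15 (1972), §4.2 Thm. 2.
* [LandauMathAnn1903] E. Landau, Math. Ann. 56 (1903), 645–670 (Primidealsatz).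
* [Marcus2018] D. A. Marcus, *Number Fields*, 2nd ed., Springer 2018, Ch. 4, Thm. 33.
-/

noncomputable section

open scoped Classical NumberField
open Filter IsDedekindDomain Field

namespace Literature.NumberTheory.EllipticCurves

open LFunctions.Chebotarev

/-- **Trace-zero automorphisms of an `𝔽_ℓ`-plane have many fixed points on `Aut(A)/H` for a
suitable subgroup `H`.**  For a prime `ℓ ≠ 2` and an `𝔽_ℓ`-plane `A` there is a subgroup
`H ≤ Aut(A)` (the monomial subgroup of `GL₂(𝔽_ℓ) ≅ Aut(A)`) such that every `g ∈ Aut(A)` of trace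
zero satisfies `⌊(ℓ − 3)/2⌋ · #H ≤ #{y : y⁻¹ g y ∈ H}` (part 5, `exists_subgroup_GL2_fixedPoints`,
transported along `exists_mulEquiv_addAut_GL2`). [cite: Serre1981, §8 Remarque 1 (p. 190)] -/
theorem exists_subgroup_addAut_fixedPoints {ℓ : ℕ} [Fact ℓ.Prime] (hℓ2 : ℓ ≠ 2) (A : Type)
    [AddCommGroup A] [Module (ZMod ℓ) A] (hA : Nat.card A = ℓ ^ 2) :
    ∃ H : Subgroup (Multiplicative (AddAut A)), ∀ g : Multiplicative (AddAut A),
      LinearMap.trace (ZMod ℓ) A ((Multiplicative.toAdd g).toAddMonoidHom.toZModLinearMap ℓ) = 0 →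
        (ℓ - 3) / 2 * Nat.card H ≤ Nat.card {y : Multiplicative (AddAut A) // y⁻¹ * g * y ∈ H} := by
  have hp : ℓ.Prime := Fact.out
  have h2 : (2 : ZMod ℓ) ≠ 0 := by
    intro h
    have h' : ((2 : ℕ) : ZMod ℓ) = 0 := by exact_mod_cast h
    rw [ZMod.natCast_eq_zero_iff] at h'
    exact hℓ2 ((Nat.prime_dvd_prime_iff_eq hp Nat.prime_two).mp h')
  obtain ⟨Φ, hΦ⟩ := exists_mulEquiv_addAut_GL2 A hA
  obtain ⟨N, hN⟩ := exists_subgroup_GL2_fixedPoints (F := ZMod ℓ) h2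
  refine ⟨N.comap Φ.toMonoidHom, fun g hg ↦ ?_⟩
  have htr : Matrix.trace ((Φ g : GL (Fin 2) (ZMod ℓ)) : Matrix (Fin 2) (Fin 2) (ZMod ℓ)) = 0 := by
    rw [hΦ, hg]
  have h := hN (Φ g) htr
  rw [ZMod.card] at h
  rw [natCard_comap_eq, natCard_conj_mem_comap_eq]
  exact h

end Literature.NumberTheory.EllipticCurves

/-! ### The assembly -/

namespace WeierstrassCurve

open Literature.NumberTheory.EllipticCurves Literature.NumberTheory.GaloisRepresentations
  Literature.NumberTheory.LFunctions Literature.NumberTheory.LFunctions.Chebotarev NumberField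
  Rat.HeightOneSpectrum

/-- **Serre 1981, §8 (a) / Thm. 20, Cor. 2 ⇐ Serre's open image theorem.**  Assume Serre's open
image theorem in mod-`ℓ` form (`serre_open_image`: for `E/ℚ` without CM, `ρ̄_{E,ℓ}` is onto
`Aut(E[ℓ])` for all large primes `ℓ`; Serre 1972, §4.2, Thm. 2).  Then for every elliptic curve
`E/ℚ` without complex multiplication the good supersingular primes have natural density `0` — the
named fact `serre_supersingular_density_zero`.  Proof (Serre 1981, p. 124 with Remarque 1,
p. 190, Chebotarev's theorem being replaced by the unconditional upper bound
`Chebotarev.eventually_card_primesLE_filter_frobPrimes_le` from the prime ideal theorem): given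
`ε > 0` pick a prime `ℓ ≥ ℓ₀(E)` with `k = ⌊(ℓ − 3)/2⌋ > 2/ε`; the primes `p ≥ 5`, `p ≠ ℓ`, of
`goodSupersingularPrimes W` have `a_p = 0` (Hasse, part 2), are unramified in `ℚ(E[ℓ])` and have
Frobenius of trace `a_p ≡ 0 (mod ℓ)` on `E[ℓ]` (part 3), i.e. lie in `frobPrimes ρ̄_{E,ℓ} C_ℓ`,
`C_ℓ = {tr = 0} ⊆ Aut(E[ℓ])`; every element of `C_ℓ` has `≥ k` fixed points on `Aut(E[ℓ])/H`
for the monomial subgroup `H` (`exists_subgroup_addAut_fixedPoints`), so this set has counting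
ratio eventually `≤ 1/k + ε/2 < ε`; conclude by the squeeze of part 1
(`hasPrimeDensity_zero_of_forall_exists_superset`). [cite: Serre1981, pp. 123–124 (a), §8 Thm. 20 Cor. 2 and Remarque 1 (pp. 189–190)] -/
theorem serre_supersingular_density_zero_of_openImage (hS : serre_open_image) :
    serre_supersingular_density_zero := by
  intro W _ _ hCM
  obtain ⟨p₀, hp₀⟩ := hS W hCM
  refine hasPrimeDensity_zero_of_forall_exists_superset fun ε hε ↦ ?_
  -- a prime `ℓ ≥ p₀`, `ℓ ≥ 5`, with `k = (ℓ - 3)/2 > 2/ε`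
  obtain ⟨ℓ, hℓge, hℓ⟩ := Nat.exists_infinite_primes (max p₀ (2 * (⌈2 / ε⌉₊ + 1) + 3))
  haveI := Fact.mk hℓ
  letI : Module (ZMod ℓ) (geomTorsion W ℓ) := AddSubgroup.torsionBy.zmodModule
  have hℓp₀ : p₀ ≤ ℓ := le_of_max_le_left hℓge
  have hℓk : ⌈2 / ε⌉₊ + 1 ≤ (ℓ - 3) / 2 := by
    have h := le_of_max_le_right hℓge
    omega
  have hℓ2 : ℓ ≠ 2 := by
    have h := le_of_max_le_right hℓge
    omega
  set k : ℕ := (ℓ - 3) / 2 with hk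
  have hkpos : 0 < k := by omega
  have hkε : 1 / (k : ℝ) < ε / 2 := by
    have h1 : (2 : ℝ) / ε < k := by
      calc (2 : ℝ) / ε ≤ ⌈2 / ε⌉₊ := Nat.le_ceil _
        _ < (⌈2 / ε⌉₊ : ℝ) + 1 := lt_add_one _
        _ ≤ k := by exact_mod_cast hℓk
    have hkpos' : (0 : ℝ) < k := by exact_mod_cast hkpos
    rw [div_lt_iff₀ hkpos']
    rw [div_lt_iff₀ hε] at h1
    linarith
  -- the mod-`ℓ` representation, its image `G = Aut(E[ℓ])`, the trace-zero locus `C`, the subgroup `H`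
  have hℓ0 : ((ℓ : ℕ) : ℤ) ≠ 0 := by exact_mod_cast hℓ.ne_zero
  haveI : Finite (geomTorsion W ℓ) := finite_torsionPoints_holds W (AlgebraicClosure ℚ) hℓ0
  haveI : Finite (AddAut (geomTorsion W ℓ)) := Finite.of_injective _ AddEquiv.toEquiv_injective
  haveI : Finite (Multiplicative (AddAut (geomTorsion W ℓ))) :=
    Finite.of_equiv _ Multiplicative.ofAdd
  set C : Set (Multiplicative (AddAut (geomTorsion W ℓ))) :=
    {g | LinearMap.trace (ZMod ℓ) (geomTorsion W ℓ)
      ((Multiplicative.toAdd g).toAddMonoidHom.toZModLinearMap ℓ) = 0} with hCdef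
  have hker : IsOpen (((galoisRepTorsion W ℓ).ker : Subgroup (absoluteGaloisGroup ℚ)) :
      Set (absoluteGaloisGroup ℚ)) := isOpen_ker_galoisRepTorsion_holds W hℓ0
  have hsurj : Function.Surjective (galoisRepTorsion W ℓ) := hp₀ ℓ hℓ hℓp₀
  have hcard : Nat.card (geomTorsion W ℓ) = ℓ ^ 2 :=
    card_torsionPoints_eq_sq_holds W (AlgebraicClosure ℚ) (n := ℓ) (by exact_mod_cast hℓ.ne_zero)
  obtain ⟨H, hH⟩ := exists_subgroup_addAut_fixedPoints hℓ2 (geomTorsion W ℓ) hcard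
  have hCk : ∀ g ∈ C, k * Nat.card H ≤
      Nat.card {y : Multiplicative (AddAut (geomTorsion W ℓ)) // y⁻¹ * g * y ∈ H} :=
    fun g hg ↦ hH g hg
  -- the unconditional upper bound for the Frobenius set of `C`
  have hbound := eventually_card_primesLE_filter_frobPrimes_le (galoisRepTorsion W ℓ) hker hsurj H
    hkpos C hCk (half_pos hε)
  refine ⟨Chebotarev.frobPrimes (galoisRepTorsion W ℓ) C, ?_, ?_⟩
  · -- the good supersingular primes outside `frobPrimes` are among `{p < 5} ∪ {ℓ}`
    refine ((Set.finite_lt_nat 5).union (Set.finite_singleton ℓ)).subset ?_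
    rintro p ⟨hpSS, hpT⟩
    by_contra hnot
    simp only [Set.mem_union, Set.mem_setOf_eq, Set.mem_singleton_iff, not_or, not_lt] at hnot
    obtain ⟨hp5, hpℓ⟩ := hnot
    obtain ⟨hp, hgood, hdvd⟩ := hpSS
    have hap : W.frobeniusTrace p = 0 :=
      (W.natCast_dvd_frobeniusTrace_iff_eq_zero p hp5 hgood).mp hdvd
    obtain ⟨v, hv⟩ : ∃ v : HeightOneSpectrum (𝓞 ℚ), (primesEquiv v : ℕ) = p :=
      ⟨primesEquiv.symm ⟨p, hp.out⟩, by rw [Equiv.apply_symm_apply]⟩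
    exact hpT ⟨v, hv,
      fun 𝔓 h𝔓 σ hσ ↦ W.galoisRepTorsion_eq_one_of_mem_inertia_prime ℓ hpℓ hgood hv h𝔓 hσ,
      fun 𝔓 h𝔓 σ hσ ↦ W.trace_galoisRepTorsion_frobenius_eq_zero ℓ hpℓ hgood hap hv h𝔓 hσ⟩
  · -- the counting ratio of `frobPrimes` is eventually `≤ 1/k + ε/2 < ε`
    filter_upwards [hbound] with x hx
    rw [primeCountingRatio_eq]
    rcases Nat.eq_zero_or_pos (Nat.primeCounting x) with h0 | hpos
    · rw [h0, Nat.cast_zero, div_zero]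
      exact hε.le
    · have hpos' : (0 : ℝ) < Nat.primeCounting x := by exact_mod_cast hpos
      rw [div_le_iff₀ hpos']
      calc ((((Nat.primesLE x).filter (· ∈ Chebotarev.frobPrimes (galoisRepTorsion W ℓ) C)).card : ℝ))
          ≤ (1 / k + ε / 2) * Nat.primeCounting x := hx
        _ ≤ ε * Nat.primeCounting x := by
            apply mul_le_mul_of_nonneg_right _ hpos'.le
            linarith

end WeierstrassCurve
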